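import Summits.QuantumFields.BalabanUV.T4Continuum.Support.ShellMeasurePlaquetteCubicLocatedRowSum

/-!
# `T4Continuum.ShellMeasurePlaquetteCubicLocatedStencil` — S77's located kernel against the pin: the THREE displayed
# inputs S77 file 4 keeps («kernel-neighbours within `R`», «incidence `≤ m`», `R` itself) REDUCED TO THE `nbhdSites`
# STENCIL — co-boundary bonds lie in the stencil, the incidence count is `≤ 4d`, the stencil's reach is `2` for S69's torus pin
(cell `pub-balaban`, sub-cell `t4`, spine estimate NE7c (node U5b); NE7c ROUND-2 crew, unit
`b2b-balaban-t4-ne7c-formalise-leaf-03` gen 6 — own-initiative junction J2′ (journal OFFER l.17837, REBASED onto S77 file 4);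
context: owner table `t4/b2b-balaban-t4-ne7c-p1/LEAVES-NE7c-P1.md` v3.5 row S77 (leaf-02-g8) — file 1
`ShellMeasurePlaquetteCubicLocated` p226772, file 3 `ShellMeasurePlaquetteCubicLocatedPinnedLevels` p227361, file 4
`ShellMeasurePlaquetteCubicLocatedRowSum` p227760; the owner's S75 f2 `ShellMeasurePinnedProp4Weighted` p226874, S69
`ShellMeasurePinnedNorm` p223286, f5d-c `ShellMeasurePlaquetteCubicAssemblyLevels` p226095, leaf-05-g7's
`ShellMeasureCommutatorGradientLocal` p222918 (the stencil); ADDITIVE — imports S77 file 4 ONLY; [folklore]; 0 `def`,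
0 `def … : Prop`, 0 sorry, 0 citation tags)

HONEST FRAMING.  Finite four-torus programme, rung (B)+1 only — NOT infinite volume, NOT a mass gap, NOT the Clay
problem, NOT summit progress; (B), `BetaPertHyp`, (B^μ) are not consumed.  NE7c (`T4IndicatorShell.ShellWeightBound`)
is NOT PRINTED in [Balaban 1983–89] and NOT PROVED; «NE7c ⇐ the named binders» (trigger c3, WALL
`t4/b2b-balaban-t4-ne7c-p1/WALL-NE7c-P1.md` §2b).  ELEMENTARY lattice combinatorics ([folklore]) on b08's lattice
`Site d = ℤᵈ` for OUR typed action; [Balaban1985Variational] (97)∕(98) LOCATE the shape only — the paper is under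
adjudication; nothing printed is asserted or cited as a fact; no estimate of Bałaban's at a live level is discharged;
the identification with Bałaban's sectioned `(δ∕δA′)V` and block variables is node O's ([dict]).  HONEST DEPENDENCY
(cell): continuum YM on T⁴ ⇐ BetaPertH ∧ nine spine estimates (0/9 proved); BetaPertH ⇐ (D1) ∧ (D4) ∧ CAP+tail; G-an2-4
gates asym, D1 and NE2/3/4.

THE POINT.  S77 file 4 (`prop4Hyp_pinned_ord₃_eta_levels_explicit`) makes the constant of the pinned (P4) binder for
OUR η-scaled (39)-split action explicit and lists as INPUTS LEFT, besides f5d-c's weights and node O: the pin hypothesis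
«kernel-neighbours of `c` — `b.1.1 ∈ nbhdSites c` OR `c, b ∈ ∂p` for some `p ∈ Pl` — are within pin-distance `R`», the
incidence count `#{p ∈ Pl : b ∈ ∂p} ≤ m`, and `R`.  All three are GEOMETRY of `ℤᵈ`:
* §1 `bond_cases`, `mem_nbhdSites_of_cases`, **`mem_nbhdSites_of_mem_bonds`**: two bonds of one plaquette `p` with
  `bd p = ∂p` lie in each other's stencil — so file 4's disjunction COLLAPSES to its first member
  (**`kernelReach_of_stencilReach`**: file 4's `hR` from the stencil-only reach
  `hreach : b.1.1 ∈ nbhdSites c.1.1 c.1.2 → ρ (posOut c) (posIn b) ≤ R`);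
* §2 **`card_filter_mem_bonds_le`**: `#{p ∈ Pl : b ∈ bonds (bd p)} ≤ 4d` from the boundary dictionary `hbd` alone (the
  plaquette is recovered from the bond's slot in `∂p` and the other direction) — f5d-c's∕file 4's `hm` DISCHARGED, `m := 4d`;
* §3 `l1_e`, **`l1_sub_le_two_of_mem_nbhdSites`** (the stencil has ℓ¹-diameter `2`) and **`reach_torusPin_le_two`**: for
  S69's torus pin geometry — positions `b ↦ proj T b.1.1 ∈ (ℤ∕T)ᵈ`, periodic ℓ¹ distance `pl1` — the stencil's reach is
  `≤ 2` (`B12Decay510Torus.pl1_proj_le_l1`: projecting never lengthens) — file 4's `R` DISCHARGED, `R := 2`;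
* §4 the ENDs re-fired BY NAME: `prop4Hyp_locGrad_ord₃_eta_levels_geom` (f5d-c's unpinned (98), `m := 4d`);
  **`prop4Hyp_pinned_ord₃_eta_levels_geom`** = file 4's `_explicit` with `hm`∕`hR` DISCHARGED (binders: its list −
  {`m`, `hm`, `hR`} + {`hreach`}; constant `(72(d−1)‖τ‖Lc³·((3d+2)d) + 8κLc⁴·(4·4d))·e^{δ′R}`, κ = ‖τ‖(248∕3·ε₀ + 40∕3·ε));
  **`prop4Hyp_pinned_ord₃_eta_levels_torusPin`** — THE CONCRETE INSTANCE: `S := TPt d T`, `ρ x y := pl1 (x − y)`,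
  `posIn = posOut := b ↦ proj T b.1.1`, `ϖ := pinDist B₀ hB₀` (S69 `pinDist_nonneg`∕`pinDist_le_add` supply `hϖ0`∕`hϖ`),
  `R := 2` ⟹ `Prop4Hyp W_pin ((72(d−1)‖τ‖Lc³·((3d+2)d) + 8κLc⁴·16d)·e^{δ′·2}) (ε∕2)` — the pinned (P4) binder of S70
  f4∕the assembled END for OUR action with NO displayed pin datum left but the block's site set `B₀ ⊆ (ℤ∕T)ᵈ` and the
  rate `δ′ ≥ 0`; η-FREE, VOLUME-FREE, k-UNIFORM.
NOT HERE: the η-display of `δ′` per fine unit (N-ne7cp1-g31-3, S79: with `δ′ = aη` the factor is `e^{2aη} ≤ e^{2a}`);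
nothing in the countdown moves; NE7c NOT PROVED; spine PROVED 0∕9.
-/

noncomputable section

open scoped BigOperators

namespace Summit.QuantumFields.BalabanUV.T4Continuum.ShellMeasurePlaquetteCubicLocatedStencil

open Literature.MathematicalPhysics.QuantumFieldTheory.Balaban1983to89
open B7Prop1Explicit (e U1 mem_U1)
open B8Ineq132 (covDerivFwd)
open B11Prop6Scheme (Prop4Hyp)
open B12Sec2to5 (l1 l1_nonneg)
open B12Decay510Window (l1_neg l1_add_le l1_sub_comm)
open B12Decay510Torus (pl1 proj_sub pl1_proj_le_l1)
open TreeLengthTorus (TPt proj)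
open ShellMeasureWilsonGradientTail (plaqWord bonds)
open ShellMeasurePlaquetteTwist (plaqFunSym)
open ShellMeasureLocalGradientTailJet (ord₃)
open Summit.QuantumFields.BalabanUV.T4Continuum.ShellMeasureCommutatorVariation (plaqStar)
open Summit.QuantumFields.BalabanUV.T4Continuum.ShellMeasureCommutatorGradientLocal
  (baseSites nbhdSites mem_nbhdSites_self mem_nbhdSites_add mem_nbhdSites_sub mem_nbhdSites_sub_add)
open Summit.QuantumFields.BalabanUV.T4Continuum.ShellMeasureCommutatorLocGrad (ext)
open Summit.QuantumFields.BalabanUV.T4Continuum.ShellMeasureLocalGradientTail (locGrad)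
open Summit.QuantumFields.BalabanUV.T4Continuum.ShellMeasureMultiGridNorms (WSup)
open Summit.QuantumFields.BalabanUV.T4Continuum.ShellMeasureMultiGridNormsMax (WMax)
open Summit.QuantumFields.BalabanUV.T4Continuum.ShellMeasurePinnedNorm (pinW pinDist pinDist_nonneg pinDist_le_add)
open Summit.QuantumFields.BalabanUV.T4Continuum.ShellMeasureWilsonRemainderLevels (etaScale)
open Summit.QuantumFields.BalabanUV.T4Continuum.ShellMeasurePlaquetteCubicAssemblyLevels
  (prop4Hyp_locGrad_ord₃_eta_levels)
open Summit.QuantumFields.BalabanUV.T4Continuum.ShellMeasurePlaquetteCubicLocatedRowSum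
  (prop4Hyp_pinned_ord₃_eta_levels_explicit)

export B7Prop1Explicit (Site)

/-! ## §1 Co-boundary bonds lie in the stencil -/

section Stencil

variable {d : ℕ}


/-- The three base sites `x`, `x + e_μ`, `x + e_ν` of the bonds of the plaquette `∂p_{μν}(x)` lie in the stencil of each
of its four bonds `(x, μ)`, `(x + e_μ, ν)`, `(x + e_ν, μ)`, `(x, ν)`. [folklore] -/
theorem mem_nbhdSites_of_cases (x : Site d) (μ ν : Fin d) {z y : Site d} {κ : Fin d}
    (hz : z = x ∨ z = x + e μ ∨ z = x + e ν)
    (hy : (y = x ∧ κ = μ) ∨ (y = x + e μ ∧ κ = ν) ∨ (y = x + e ν ∧ κ = μ) ∨ (y = x ∧ κ = ν)) :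
    z ∈ nbhdSites y κ := by
  rcases hy with ⟨rfl, rfl⟩ | ⟨rfl, rfl⟩ | ⟨rfl, rfl⟩ | ⟨rfl, rfl⟩
  · rcases hz with rfl | rfl | rfl
    · exact mem_nbhdSites_self _ _
    · exact mem_nbhdSites_add _ _ _
    · exact mem_nbhdSites_add _ _ _
  · rcases hz with rfl | rfl | rfl
    · simpa only [add_sub_cancel_right] using mem_nbhdSites_sub (z + e μ) κ μ
    · exact mem_nbhdSites_self _ _
    · simpa only [add_sub_cancel_right] using mem_nbhdSites_sub_add (x + e μ) κ μ
  · rcases hz with rfl | rfl | rfl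
    · simpa only [add_sub_cancel_right] using mem_nbhdSites_sub (z + e ν) κ ν
    · simpa only [add_sub_cancel_right] using mem_nbhdSites_sub_add (x + e ν) κ ν
    · exact mem_nbhdSites_self _ _
  · rcases hz with rfl | rfl | rfl
    · exact mem_nbhdSites_self _ _
    · exact mem_nbhdSites_add _ _ _
    · exact mem_nbhdSites_add _ _ _

variable {Λ : Finset (Site d × Fin d)} {bd : Fin d × Fin d × Site d → (Fin 4 → ↥Λ × Bool)}
  {p : Fin d × Fin d × Site d}

/-- The four bonds of `∂p_{μν}(x)` as base-site∕direction pairs (from the boundary dictionary `hbd`). [folklore] -/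
theorem bond_cases
    (hbd : ((bd p 0).1 : Site d × Fin d) = (p.2.2, p.1) ∧ ((bd p 1).1 : Site d × Fin d) = (p.2.2 + e p.1, p.2.1)
      ∧ ((bd p 2).1 : Site d × Fin d) = (p.2.2 + e p.2.1, p.1) ∧ ((bd p 3).1 : Site d × Fin d) = (p.2.2, p.2.1))
    {c : ↥Λ} (hc : c ∈ bonds (bd p)) :
    (c.1.1 = p.2.2 ∧ c.1.2 = p.1) ∨ (c.1.1 = p.2.2 + e p.1 ∧ c.1.2 = p.2.1) ∨
      (c.1.1 = p.2.2 + e p.2.1 ∧ c.1.2 = p.1) ∨ (c.1.1 = p.2.2 ∧ c.1.2 = p.2.1) := by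
  obtain ⟨i, -, hi⟩ := Finset.mem_image.1 hc
  obtain ⟨h0, h1, h2, h3⟩ := hbd
  have key : (c.1 : Site d × Fin d) = (p.2.2, p.1) ∨ (c.1 : Site d × Fin d) = (p.2.2 + e p.1, p.2.1) ∨
      (c.1 : Site d × Fin d) = (p.2.2 + e p.2.1, p.1) ∨ (c.1 : Site d × Fin d) = (p.2.2, p.2.1) := by
    rw [← hi]
    fin_cases i
    · exact Or.inl h0
    · exact Or.inr (Or.inl h1)
    · exact Or.inr (Or.inr (Or.inl h2))
    · exact Or.inr (Or.inr (Or.inr h3))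
  rcases key with h | h | h | h
  · exact Or.inl (Prod.ext_iff.1 h)
  · exact Or.inr (Or.inl (Prod.ext_iff.1 h))
  · exact Or.inr (Or.inr (Or.inl (Prod.ext_iff.1 h)))
  · exact Or.inr (Or.inr (Or.inr (Prod.ext_iff.1 h)))

/-- **TWO BONDS OF ONE PLAQUETTE LIE IN EACH OTHER'S STENCIL**: for `p` with `bd p = ∂p` and `c, b ∈ bonds (bd p)`,
`b.1.1 ∈ nbhdSites c.1.1 c.1.2` — the plaquette summand of S77's located kernel is supported in the `nbhdSites` stencil.
[folklore] -/
theorem mem_nbhdSites_of_mem_bonds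
    (hbd : ((bd p 0).1 : Site d × Fin d) = (p.2.2, p.1) ∧ ((bd p 1).1 : Site d × Fin d) = (p.2.2 + e p.1, p.2.1)
      ∧ ((bd p 2).1 : Site d × Fin d) = (p.2.2 + e p.2.1, p.1) ∧ ((bd p 3).1 : Site d × Fin d) = (p.2.2, p.2.1))
    {c b : ↥Λ} (hc : c ∈ bonds (bd p)) (hb : b ∈ bonds (bd p)) : b.1.1 ∈ nbhdSites c.1.1 c.1.2 := by
  have hz : b.1.1 = p.2.2 ∨ b.1.1 = p.2.2 + e p.1 ∨ b.1.1 = p.2.2 + e p.2.1 := by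
    rcases bond_cases hbd hb with h | h | h | h
    · exact Or.inl h.1
    · exact Or.inr (Or.inl h.1)
    · exact Or.inr (Or.inr h.1)
    · exact Or.inl h.1
  exact mem_nbhdSites_of_cases p.2.2 p.1 p.2.1 hz (bond_cases hbd hc)

/-- **FILE 4's PIN HYPOTHESIS FROM THE STENCIL-ONLY REACH.**  With boundaries `bd p = ∂p` on `Pl`, «kernel-neighbours of
`c` (`b.1.1 ∈ nbhdSites c` or `c, b ∈ ∂p` for some `p ∈ Pl`) are within pin-distance `R`» follows from the reach of the
stencil alone, `b.1.1 ∈ nbhdSites c.1.1 c.1.2 → ρ (posOut c) (posIn b) ≤ R` — the second disjunct is a sub-case of the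
first (`mem_nbhdSites_of_mem_bonds`). [folklore] -/
theorem kernelReach_of_stencilReach (Pl : Finset (Fin d × Fin d × Site d))
    (hbd : ∀ p ∈ Pl, ((bd p 0).1 : Site d × Fin d) = (p.2.2, p.1) ∧ ((bd p 1).1 : Site d × Fin d) = (p.2.2 + e p.1, p.2.1)
      ∧ ((bd p 2).1 : Site d × Fin d) = (p.2.2 + e p.2.1, p.1) ∧ ((bd p 3).1 : Site d × Fin d) = (p.2.2, p.2.1))
    {S : Type*} (ρ : S → S → ℝ) (posIn posOut : ↥Λ → S) {R : ℝ}
    (hreach : ∀ c b : ↥Λ, b.1.1 ∈ nbhdSites c.1.1 c.1.2 → ρ (posOut c) (posIn b) ≤ R) (c b : ↥Λ)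
    (hb : b.1.1 ∈ nbhdSites c.1.1 c.1.2 ∨ ∃ p ∈ Pl, c ∈ bonds (bd p) ∧ b ∈ bonds (bd p)) :
    ρ (posOut c) (posIn b) ≤ R := by
  rcases hb with hb | ⟨p, hp, hc, hb⟩
  · exact hreach c b hb
  · exact hreach c b (mem_nbhdSites_of_mem_bonds (hbd p hp) hc hb)


/-! ## §2 The incidence count -/

/-- **THE INCIDENCE COUNT (f5d-c's `hm`) IS GEOMETRIC**: with boundaries `bd p = ∂p` on `Pl`, at most `4d` plaquettes
of `Pl` have a given bond on their boundary (the plaquette is recovered from the position of the bond in its boundary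
and the other direction). [folklore] -/
theorem card_filter_mem_bonds_le (Pl : Finset (Fin d × Fin d × Site d))
    (hbd : ∀ p ∈ Pl, ((bd p 0).1 : Site d × Fin d) = (p.2.2, p.1) ∧ ((bd p 1).1 : Site d × Fin d) = (p.2.2 + e p.1, p.2.1)
      ∧ ((bd p 2).1 : Site d × Fin d) = (p.2.2 + e p.2.1, p.1) ∧ ((bd p 3).1 : Site d × Fin d) = (p.2.2, p.2.1))
    (b : ↥Λ) : (Pl.filter (fun p => b ∈ bonds (bd p))).card ≤ 4 * d := by
  classical
  set y : Site d := b.1.1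
  set κ : Fin d := b.1.2
  set g₀ : Fin d → Fin d × Fin d × Site d := fun lam => (κ, lam, y)
  set g₁ : Fin d → Fin d × Fin d × Site d := fun lam => (lam, κ, y - e lam)
  set g₂ : Fin d → Fin d × Fin d × Site d := fun lam => (κ, lam, y - e lam)
  set g₃ : Fin d → Fin d × Fin d × Site d := fun lam => (lam, κ, y)
  have hsub : Pl.filter (fun p => b ∈ bonds (bd p)) ⊆
      ((Finset.univ.image g₀ ∪ Finset.univ.image g₁) ∪ Finset.univ.image g₂) ∪ Finset.univ.image g₃ := by
    intro p hp
    rw [Finset.mem_filter] at hp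
    obtain ⟨μ, ν, x⟩ := p
    simp only [Finset.mem_union, Finset.mem_image, Finset.mem_univ, true_and]
    rcases bond_cases (hbd _ hp.1) hp.2 with ⟨h1, h2⟩ | ⟨h1, h2⟩ | ⟨h1, h2⟩ | ⟨h1, h2⟩
    · refine Or.inl (Or.inl (Or.inl ⟨ν, ?_⟩))
      simp only [g₀, y, κ, h1, h2]
    · refine Or.inl (Or.inl (Or.inr ⟨μ, ?_⟩))
      simp only [g₁, y, κ, h1, h2, add_sub_cancel_right]
    · refine Or.inl (Or.inr ⟨ν, ?_⟩)
      simp only [g₂, y, κ, h1, h2, add_sub_cancel_right]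
    · refine Or.inr ⟨μ, ?_⟩
      simp only [g₃, y, κ, h1, h2]
  have himg : ∀ g : Fin d → Fin d × Fin d × Site d, (Finset.univ.image g).card ≤ d := fun g =>
    Finset.card_image_le.trans (by simp)
  calc (Pl.filter (fun p => b ∈ bonds (bd p))).card
      ≤ (((Finset.univ.image g₀ ∪ Finset.univ.image g₁) ∪ Finset.univ.image g₂) ∪ Finset.univ.image g₃).card :=
        Finset.card_le_card hsub
    _ ≤ (((Finset.univ.image g₀).card + (Finset.univ.image g₁).card) + (Finset.univ.image g₂).card)
          + (Finset.univ.image g₃).card := by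
        refine (Finset.card_union_le _ _).trans (Nat.add_le_add_right ?_ _)
        refine (Finset.card_union_le _ _).trans (Nat.add_le_add_right ?_ _)
        exact Finset.card_union_le _ _
    _ ≤ ((d + d) + d) + d := by gcongr <;> exact himg _
    _ = 4 * d := by ring

/-! ## §3 The stencil has ℓ¹-diameter two; reach two under the torus pin -/

/-- `|e_μ|₁ = 1`. [folklore] -/
theorem l1_e (μ : Fin d) : l1 (e μ) = 1 := by
  unfold B12Sec2to5.l1 B7Prop1Explicit.e
  rw [Finset.sum_eq_single μ (fun i _ hi => by simp [hi]) (fun h => absurd (Finset.mem_univ μ) h)]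
  simp

/-- **THE STENCIL HAS ℓ¹-DIAMETER TWO**: `z ∈ nbhdSites y κ ⟹ |z − y|₁ ≤ 2`. [folklore] -/
theorem l1_sub_le_two_of_mem_nbhdSites {y z : Site d} {κ : Fin d} (hz : z ∈ nbhdSites y κ) : l1 (z - y) ≤ 2 := by
  unfold nbhdSites at hz
  simp only [Finset.mem_insert, Finset.mem_biUnion, Finset.mem_univ, true_and, Finset.mem_singleton] at hz
  have h0 : l1 ((0 : Site d)) = 0 := by simp [B12Sec2to5.l1]
  rcases hz with rfl | rfl | ⟨ν, rfl | rfl | rfl⟩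
  · rw [sub_self, h0]; norm_num
  · rw [add_sub_cancel_left, l1_e]; norm_num
  · rw [add_sub_cancel_left, l1_e]; norm_num
  · rw [sub_sub_cancel_left, l1_neg, l1_e]; norm_num
  · have h : y - e ν + e κ - y = e κ + -e ν := by abel
    rw [h]
    calc l1 (e κ + -e ν) ≤ l1 (e κ) + l1 (-e ν) := l1_add_le _ _
      _ = 2 := by rw [l1_neg, l1_e, l1_e]; norm_num

/-- **THE STENCIL'S REACH UNDER THE TORUS PIN IS TWO**: with positions `b ↦ proj T b.1.1 ∈ (ℤ∕T)ᵈ` and the periodic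
ℓ¹ distance, `b.1.1 ∈ nbhdSites c.1.1 c.1.2 ⟹ pl1 (proj T c.1.1 − proj T b.1.1) ≤ 2` (projection never lengthens;
the stencil has ℓ¹-diameter two). [folklore] -/
theorem reach_torusPin_le_two (T : ℕ) [NeZero T] {Λ : Finset (Site d × Fin d)} (c b : ↥Λ)
    (hb : b.1.1 ∈ nbhdSites c.1.1 c.1.2) : pl1 (proj T c.1.1 - proj T b.1.1) ≤ 2 := by
  rw [← proj_sub]
  calc pl1 (proj T (c.1.1 - b.1.1)) ≤ l1 (c.1.1 - b.1.1) := pl1_proj_le_l1 _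
    _ = l1 (b.1.1 - c.1.1) := l1_sub_comm _ _
    _ ≤ 2 := l1_sub_le_two_of_mem_nbhdSites hb

end Stencil

/-! ## §4 The ENDs re-fired: incidence, reach and (for the torus pin) `R` discharged -/

section Ends

variable {d : ℕ} {𝔸 : Type*} [NormedRing 𝔸] [NormOneClass 𝔸] [NormedAlgebra ℂ 𝔸] [CompleteSpace 𝔸]
  (Λ : Finset (Site d × Fin d)) (Pl : Finset (Fin d × Fin d × Site d)) (τ : 𝔸 →L[ℂ] ℂ)
  {U₀ : Site d → Fin d → 𝔸ˣ} (h₀ : ∀ y κ, U₀ y κ ∈ U1 𝔸) (bd : Fin d × Fin d × Site d → (Fin 4 → ↥Λ × Bool))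
  (wt : ↥Λ → ℝ) [hwt : Fact (∀ b, 0 < wt b)] {I : Type*} [Fintype I] (wd : I → ℝ) [hwd : Fact (∀ i, 0 < wd i)]
  (Dv : (↥Λ → 𝔸) →L[ℂ] (I → 𝔸)) (Wf Wd : ↥Λ → ℝ) (W : Fin d × Fin d × Site d → ℝ)

include h₀ in
/-- **f5d-c's (98) WITH THE INCIDENCE COUNT DISCHARGED** (`m := 4d`, §1 `card_filter_mem_bonds_le`): the unpinned
`Prop4Hyp` of OUR η-scaled action's order-≥3 part at the live levels with constant
`72(d−1)‖τ‖Lc³ + 8‖τ‖(248∕3·ε₀ + 40∕3·ε)·4d·Lc⁴` — every remaining hypothesis a weight∕floor∕regularity datum.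
[folklore] -/
theorem prop4Hyp_locGrad_ord₃_eta_levels_geom {η : ℝ} (hη : 0 < η) (htr : ∀ P Q : 𝔸, τ (P * Q) = τ (Q * P))
    (hincr : ∀ p ∈ Pl, p.1 < p.2.1) (hst : ∀ b : ↥Λ, plaqStar b.1.1 b.1.2 ⊆ Pl)
    (hbd : ∀ p ∈ Pl, ((bd p 0).1 : Site d × Fin d) = (p.2.2, p.1) ∧ ((bd p 1).1 : Site d × Fin d) = (p.2.2 + e p.1, p.2.1)
      ∧ ((bd p 2).1 : Site d × Fin d) = (p.2.2 + e p.2.1, p.1) ∧ ((bd p 3).1 : Site d × Fin d) = (p.2.2, p.2.1))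
    (hor : ∀ p ∈ Pl, (bd p 0).2 = true ∧ (bd p 1).2 = true ∧ (bd p 2).2 = false ∧ (bd p 3).2 = false)
    {Lc : ℝ} (hLc : 1 ≤ Lc) (hWf0 : ∀ b, 0 < Wf b) (hWd0 : ∀ b, 0 < Wd b)
    (hWf : ∀ b b' : ↥Λ, b'.1.1 ∈ nbhdSites b.1.1 b.1.2 → Wf b ≤ wt b')
    (hcf : ∀ b, wt b ≤ Lc * Wf b) (hcd : ∀ b, wt b ≤ Lc * Wd b)
    (hDv : ∀ (A : ↥Λ → 𝔸) (b : ↥Λ) (x : Site d) (κ' τ' : Fin d), x ∈ baseSites b.1.1 →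
      Wd b ^ 2 * ‖covDerivFwd η U₀ κ' (fun z => ext Λ A z τ') x‖ ≤ ‖(WSup.toPiL wd 2).symm (Dv A)‖)
    {ε ε₀ : ℝ} (hε : 0 < ε) (hε₀ : 0 ≤ ε₀) (hε4 : 4 * ε ≤ 1) (hηW : ∀ p ∈ Pl, η ≤ W p)
    (hWw : ∀ p ∈ Pl, ∀ b ∈ bonds (bd p), W p ≤ wt b) (hwW : ∀ p ∈ Pl, ∀ b ∈ bonds (bd p), wt b ≤ Lc * W p)
    (hreg : ∀ p ∈ Pl, ‖(plaqWord (fun b : ↥Λ => U₀ b.1.1 b.1.2) (bd p) (0 : ↥Λ → 𝔸) : 𝔸) - 1‖ ≤ ε₀ * (η / W p) ^ 2) :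
    Prop4Hyp (fun Y : WMax wt wd Dv =>
        (WSup.toPiL wt 3).symm
          (locGrad (etaScale η (fun A : ↥Λ → 𝔸 =>
              ∑ p ∈ Pl, ord₃ (plaqFunSym τ (fun b : ↥Λ => U₀ b.1.1 b.1.2) (bd p)) A))
            (WMax.toPiL wt wd Dv Y)))
      (72 * ((d : ℝ) - 1) * ‖τ‖ * Lc ^ 3 + 8 * ‖τ‖ * (248 / 3 * ε₀ + 40 / 3 * ε) * (4 * d : ℕ) * Lc ^ 4) (ε / 2) :=
  prop4Hyp_locGrad_ord₃_eta_levels Λ Pl τ h₀ bd wt wd Dv Wf Wd W hη htr hincr hst hbd hor hLc hWf0 hWd0 hWf hcf hcd hDv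
    hε hε₀ hε4 hηW hWw hwW hreg (card_filter_mem_bonds_le Pl hbd)

include h₀ in
/-- **THE PINNED (P4) BINDER FOR OUR ACTION WITH THE PIN INPUTS REDUCED TO THE STENCIL's REACH.**  S77 file 4's
`prop4Hyp_pinned_ord₃_eta_levels_explicit` with its incidence count DISCHARGED (`m := 4d`, §2) and its pin hypothesis
REPLACED by the stencil-only reach `hreach : b.1.1 ∈ nbhdSites c.1.1 c.1.2 → ρ (posOut c) (posIn b) ≤ R` (§1); every
other hypothesis VERBATIM (f5d-c's weights∕floors∕regularity, the pin `ϖ ≥ 0` one-sided Lipschitz for `ρ`, `δ′ ≥ 0`,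
`1 ≤ d`).  Constant `(72(d−1)‖τ‖Lc³·((3d+2)d) + 8κLc⁴·(4·4d))·e^{δ′R}`, κ = ‖τ‖(248∕3·ε₀ + 40∕3·ε) — η-FREE, VOLUME-FREE,
k-UNIFORM ([Balaban1985Variational] (98) TYPE for OUR action, located and pinned; nothing printed is asserted). [folklore] -/
theorem prop4Hyp_pinned_ord₃_eta_levels_geom {η : ℝ} (hη : 0 < η) (htr : ∀ P Q : 𝔸, τ (P * Q) = τ (Q * P))
    (hincr : ∀ p ∈ Pl, p.1 < p.2.1) (hst : ∀ b : ↥Λ, plaqStar b.1.1 b.1.2 ⊆ Pl)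
    (hbd : ∀ p ∈ Pl, ((bd p 0).1 : Site d × Fin d) = (p.2.2, p.1) ∧ ((bd p 1).1 : Site d × Fin d) = (p.2.2 + e p.1, p.2.1)
      ∧ ((bd p 2).1 : Site d × Fin d) = (p.2.2 + e p.2.1, p.1) ∧ ((bd p 3).1 : Site d × Fin d) = (p.2.2, p.2.1))
    (hor : ∀ p ∈ Pl, (bd p 0).2 = true ∧ (bd p 1).2 = true ∧ (bd p 2).2 = false ∧ (bd p 3).2 = false)
    {Lc : ℝ} (hLc : 1 ≤ Lc) (hWd0 : ∀ b, 0 < Wd b)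
    (hWf : ∀ b b' : ↥Λ, b'.1.1 ∈ nbhdSites b.1.1 b.1.2 → Wf b ≤ wt b')
    (hcf : ∀ b, wt b ≤ Lc * Wf b) (hcd : ∀ b, wt b ≤ Lc * Wd b)
    (hDv : ∀ (A : ↥Λ → 𝔸) (b : ↥Λ) (x : Site d) (κ' τ' : Fin d), x ∈ baseSites b.1.1 →
      Wd b ^ 2 * ‖covDerivFwd η U₀ κ' (fun z => ext Λ A z τ') x‖ ≤ ‖(WSup.toPiL wd 2).symm (Dv A)‖)
    {ε ε₀ : ℝ} (hε : 0 < ε) (hε₀ : 0 ≤ ε₀) (hε4 : 4 * ε ≤ 1) (hηW : ∀ p ∈ Pl, η ≤ W p)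
    (hWw : ∀ p ∈ Pl, ∀ b ∈ bonds (bd p), W p ≤ wt b) (hwW : ∀ p ∈ Pl, ∀ b ∈ bonds (bd p), wt b ≤ Lc * W p)
    (hreg : ∀ p ∈ Pl, ‖(plaqWord (fun b : ↥Λ => U₀ b.1.1 b.1.2) (bd p) (0 : ↥Λ → 𝔸) : 𝔸) - 1‖ ≤ ε₀ * (η / W p) ^ 2)
    (hd1 : 1 ≤ d) {S : Type*} (ρ : S → S → ℝ) (posIn posOut : ↥Λ → S) (ϖ : S → ℝ) {δ' R : ℝ} (hδ' : 0 ≤ δ')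
    (hϖ0 : ∀ x, 0 ≤ ϖ x) (hϖ : ∀ x y, ϖ x ≤ ϖ y + ρ x y)
    (hreach : ∀ c b : ↥Λ, b.1.1 ∈ nbhdSites c.1.1 c.1.2 → ρ (posOut c) (posIn b) ≤ R) :
    Prop4Hyp (fun Y : WMax (fun b => wt b * pinW δ' (ϖ ∘ posIn) b) wd Dv =>
        ((WSup.toPiL (fun c => wt c ^ 3 * pinW δ' (ϖ ∘ posOut) c) 1).symm
          (locGrad (etaScale η (fun A : ↥Λ → 𝔸 =>
              ∑ p ∈ Pl, ord₃ (plaqFunSym τ (fun b : ↥Λ => U₀ b.1.1 b.1.2) (bd p)) A))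
            (WMax.toPiL (fun b => wt b * pinW δ' (ϖ ∘ posIn) b) wd Dv Y)) :
          WSup (fun c => wt c ^ 3 * pinW δ' (ϖ ∘ posOut) c) 1 (𝔸 →L[ℂ] ℂ)))
      ((72 * ((d : ℝ) - 1) * ‖τ‖ * Lc ^ 3 * ((3 * d + 2) * d : ℕ)
          + 8 * (‖τ‖ * (248 / 3 * ε₀ + 40 / 3 * ε)) * Lc ^ 4 * (4 * (4 * d : ℕ))) * Real.exp (δ' * R))
      (ε / 2) :=
  prop4Hyp_pinned_ord₃_eta_levels_explicit Λ Pl τ h₀ bd wt wd Dv Wf Wd W hη htr hincr hst hbd hor hLc hWd0 hWf hcf hcd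
    hDv hε hε₀ hε4 hηW hWw hwW hreg (card_filter_mem_bonds_le Pl hbd) hd1 ρ posIn posOut ϖ hδ' hϖ0 hϖ
    (kernelReach_of_stencilReach Pl hbd ρ posIn posOut hreach)

include h₀ in
/-- **THE CONCRETE INSTANCE — S69's TORUS PIN OF THE BLOCK, NO DISPLAYED PIN DATUM LEFT.**  f5d-c's geometric hypotheses
verbatim + `1 ≤ d`; the pin is S69's `pinDist B₀ hB₀` of a nonempty site set `B₀ ⊆ (ℤ∕T)ᵈ` (the block), read at the
bonds' base sites `proj T b.1.1`, with the periodic ℓ¹ distance `pl1` and a rate `δ′ ≥ 0`; `hϖ0`∕`hϖ` are S69's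
`pinDist_nonneg`∕`pinDist_le_add` and the reach is `2` (§3).  Conclusion:
`Prop4Hyp W_pin ((72(d−1)‖τ‖Lc³·((3d+2)d) + 8κLc⁴·16d)·e^{δ′·2}) (ε∕2)` for
`W := locGrad (etaScale η (Σ_{p∈Pl} ord₃ plaqFunSym_p))` between `WMax (wt·e^{δ′ pinDist∘proj}) wd Dv` and
`WSup ((wt)³·e^{δ′ pinDist∘proj}) 1 (𝔸 →L[ℂ] ℂ)` — η-FREE, VOLUME-FREE, k-UNIFORM. [folklore] -/
theorem prop4Hyp_pinned_ord₃_eta_levels_torusPin {η : ℝ} (hη : 0 < η) (htr : ∀ P Q : 𝔸, τ (P * Q) = τ (Q * P))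
    (hincr : ∀ p ∈ Pl, p.1 < p.2.1) (hst : ∀ b : ↥Λ, plaqStar b.1.1 b.1.2 ⊆ Pl)
    (hbd : ∀ p ∈ Pl, ((bd p 0).1 : Site d × Fin d) = (p.2.2, p.1) ∧ ((bd p 1).1 : Site d × Fin d) = (p.2.2 + e p.1, p.2.1)
      ∧ ((bd p 2).1 : Site d × Fin d) = (p.2.2 + e p.2.1, p.1) ∧ ((bd p 3).1 : Site d × Fin d) = (p.2.2, p.2.1))
    (hor : ∀ p ∈ Pl, (bd p 0).2 = true ∧ (bd p 1).2 = true ∧ (bd p 2).2 = false ∧ (bd p 3).2 = false)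
    {Lc : ℝ} (hLc : 1 ≤ Lc) (hWd0 : ∀ b, 0 < Wd b)
    (hWf : ∀ b b' : ↥Λ, b'.1.1 ∈ nbhdSites b.1.1 b.1.2 → Wf b ≤ wt b')
    (hcf : ∀ b, wt b ≤ Lc * Wf b) (hcd : ∀ b, wt b ≤ Lc * Wd b)
    (hDv : ∀ (A : ↥Λ → 𝔸) (b : ↥Λ) (x : Site d) (κ' τ' : Fin d), x ∈ baseSites b.1.1 →
      Wd b ^ 2 * ‖covDerivFwd η U₀ κ' (fun z => ext Λ A z τ') x‖ ≤ ‖(WSup.toPiL wd 2).symm (Dv A)‖)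
    {ε ε₀ : ℝ} (hε : 0 < ε) (hε₀ : 0 ≤ ε₀) (hε4 : 4 * ε ≤ 1) (hηW : ∀ p ∈ Pl, η ≤ W p)
    (hWw : ∀ p ∈ Pl, ∀ b ∈ bonds (bd p), W p ≤ wt b) (hwW : ∀ p ∈ Pl, ∀ b ∈ bonds (bd p), wt b ≤ Lc * W p)
    (hreg : ∀ p ∈ Pl, ‖(plaqWord (fun b : ↥Λ => U₀ b.1.1 b.1.2) (bd p) (0 : ↥Λ → 𝔸) : 𝔸) - 1‖ ≤ ε₀ * (η / W p) ^ 2)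
    (hd1 : 1 ≤ d) {T : ℕ} [NeZero T] (B₀ : Finset (TPt d T)) (hB₀ : B₀.Nonempty) {δ' : ℝ} (hδ' : 0 ≤ δ') :
    Prop4Hyp (fun Y : WMax (fun b => wt b * pinW δ' (pinDist B₀ hB₀ ∘ fun b : ↥Λ => proj T b.1.1) b) wd Dv =>
        ((WSup.toPiL (fun c => wt c ^ 3 * pinW δ' (pinDist B₀ hB₀ ∘ fun b : ↥Λ => proj T b.1.1) c) 1).symm
          (locGrad (etaScale η (fun A : ↥Λ → 𝔸 =>
              ∑ p ∈ Pl, ord₃ (plaqFunSym τ (fun b : ↥Λ => U₀ b.1.1 b.1.2) (bd p)) A))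
            (WMax.toPiL (fun b => wt b * pinW δ' (pinDist B₀ hB₀ ∘ fun b : ↥Λ => proj T b.1.1) b) wd Dv Y)) :
          WSup (fun c => wt c ^ 3 * pinW δ' (pinDist B₀ hB₀ ∘ fun b : ↥Λ => proj T b.1.1) c) 1 (𝔸 →L[ℂ] ℂ)))
      ((72 * ((d : ℝ) - 1) * ‖τ‖ * Lc ^ 3 * ((3 * d + 2) * d : ℕ)
          + 8 * (‖τ‖ * (248 / 3 * ε₀ + 40 / 3 * ε)) * Lc ^ 4 * (4 * (4 * d : ℕ))) * Real.exp (δ' * 2))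
      (ε / 2) :=
  prop4Hyp_pinned_ord₃_eta_levels_geom Λ Pl τ h₀ bd wt wd Dv Wf Wd W hη htr hincr hst hbd hor hLc hWd0 hWf hcf hcd hDv
    hε hε₀ hε4 hηW hWw hwW hreg hd1 (fun x y : TPt d T => pl1 (x - y)) (fun b : ↥Λ => proj T b.1.1)
    (fun b : ↥Λ => proj T b.1.1) (pinDist B₀ hB₀) hδ' (pinDist_nonneg B₀ hB₀) (pinDist_le_add B₀ hB₀)
    (fun c b hb => reach_torusPin_le_two T c b hb)

end Ends

end Summit.QuantumFields.BalabanUV.T4Continuum.ShellMeasurePlaquetteCubicLocatedStencil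

end
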